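import Summits.SmoothPoincare4.SmoothPoincare4.Theorems.DottedCircleRasmussenDcrGapStubFriendsH2HF3
import Summits.SmoothPoincare4.SmoothPoincare4.Theses.DottedCircleRasmussen

/-!
# Helper `helper_friendsCarrier_Vk_levelField` (piece 2 of the registered helper `helper_friendsCarrier_Vk`,
stub `stub_friendsCarrier`, line `mk_friends`, skeleton v5) for crux `DcrGap`
(item stmt-SmoothPoincare4-16128, route route-SmoothPoincare4-DottedCircleRasmussen)

**Milnor's unit-clock field for the model level function.**  Companion of
`helper_friendsCarrier_Vk_clockFlow` (the exterior collar of `M_k = ∂D_k` as the flow of any compactly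
supported smooth field `V` with `dG_k(V) = 1` on the clock zone): this file supplies such a field.  For
`0 < ε ≤ 1/200` there is a `C^∞` vector field `V` on `ℝ⁴`, vanishing outside the ball of radius
`2 · 40(k+1)`, with `dG_k(V) = 1` on the clock zone `{∀ j, |z - c_j|² > 1/2} ∩ {|G_k - 1| < 3ε}`.
It is `V = (φ(G_k)/|∇G_k|²) ∇G_k` with `φ` a plateau cutoff (`= 1` on `[1 - 3ε, 1 + 3ε]`, supported in
`(1 - 9ε, 1 + 9ε)`, from `Real.smoothTransition`, reusing `FriendsH2.cutoff_*`) and `V = 0` near the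
poles `z = c_j` (where `G_k > 2`): Milnor, *Morse theory* (1963), proof of Thm. 3.1, for the
critical-point-free band of `G_k` around `1` (`MMSW.gradSq_pos`: the planar gradient does not vanish
where the planar potential is `≥ 19/20`; otherwise `|w| > 0`).  The smoothness bookkeeping is that of
the pushing field of `DottedCircleRasmussenDcrGapStubFriendsH2HF3.lean`.

No definitions, no named facts, no `sorry`.

## References

* J. Milnor, *Morse theory*, Ann. of Math. Studies 51 (1963), Thm. 3.1. [Milnor1963]
-/

-- the prescribed namespace `Summit.<P>.<Sub>.…` duplicates `SmoothPoincare4` (P = Sub)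
set_option linter.dupNamespace false
set_option linter.style.longLine false

noncomputable section

open scoped ContDiff Topology
open Set Function Metric Filter
open Literature.Topology.FourManifolds Literature.Topology.FourManifolds.MMSW

namespace Summit.SmoothPoincare4.SmoothPoincare4.Theorems.DcrGap.MkFriends

namespace FriendsCarrierVk

/-- **Milnor's unit-clock field** `V = (φ(G_k)/|∇G_k|²) ∇G_k`: smooth, supported in the ball of radius
`2 · 40(k+1)`, with `dG_k(V) = 1` on the clock zone `{∀ j, |z - c_j|² > 1/2} ∩ {|G_k - 1| < 3ε}`,
`0 < ε ≤ 1/200`. [cite: Milnor1963, Thm. 3.1] -/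
theorem exists_levelField (k : ℕ) {ε : ℝ} (hε0 : 0 < ε) (hε : ε ≤ 1 / 200) :
    ∃ V : EuclideanSpace ℝ (Fin 4) → EuclideanSpace ℝ (Fin 4), ContDiff ℝ ∞ V ∧
      (∀ y, 2 * (40 * ((k : ℝ) + 1)) ≤ ‖y‖ → V y = 0) ∧
      (∀ y, (∀ j, (1 : ℝ) / 2 < holeTerm k j y) → |levelFun k y - 1| < 3 * ε →
        fderiv ℝ (levelFun k) y (V y) = 1) := by
  have hR40 : (40 : ℝ) ≤ 40 * ((k : ℝ) + 1) := by nlinarith [(k.cast_nonneg : (0 : ℝ) ≤ k)]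
  set R : ℝ := 40 * ((k : ℝ) + 1) with hRdef
  have h6ε : 0 < 6 * ε := by positivity
  -- the cutoff (plateau `[1 - 3ε, 1 + 3ε]`, support `(1 - 9ε, 1 + 9ε)`), the half-gradient, the field
  set φ : ℝ → ℝ := fun g => Real.smoothTransition ((g + 3 * ε - (1 - 6 * ε)) / (6 * ε)) *
    Real.smoothTransition ((1 + 2 * (6 * ε) - (g + 3 * ε)) / (6 * ε)) with hφ
  have hφs : ContDiff ℝ ∞ φ :=
    (FriendsH2.cutoff_contDiff (6 * ε)).comp (contDiff_id.add contDiff_const)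
  have hφ1 : ∀ g, 1 - 3 * ε ≤ g → g ≤ 1 + 3 * ε → φ g = 1 := fun g h1 h2 =>
    FriendsH2.cutoff_eq_one h6ε (by linarith) (by linarith)
  have hφ0 : ∀ g, φ g ≠ 0 → 1 - 9 * ε < g ∧ g < 1 + 9 * ε := fun g h => by
    have := FriendsH2.cutoff_ne_zero h6ε h
    constructor <;> linarith [this.1, this.2]
  set a : EuclideanSpace ℝ (Fin 4) → ℝ := fun y => y 0 / (40 * ((k : ℝ) + 1)) ^ 2 -
    ∑ j : Fin k, (y 0 - 4 * (((j : ℕ) : ℝ) + 1)) / holeTerm k j y ^ 2 with ha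
  set b : EuclideanSpace ℝ (Fin 4) → ℝ := fun y => y 1 / (40 * ((k : ℝ) + 1)) ^ 2 -
    ∑ j : Fin k, y 1 / holeTerm k j y ^ 2 with hb
  set gradG : EuclideanSpace ℝ (Fin 4) → EuclideanSpace ℝ (Fin 4) :=
    fun y => !₂[a y, b y, y 2, y 3] with hgradG
  set S : EuclideanSpace ℝ (Fin 4) → ℝ := fun y => a y ^ 2 + b y ^ 2 + y 2 ^ 2 + y 3 ^ 2 with hS
  set χ : EuclideanSpace ℝ (Fin 4) → ℝ :=
    fun y => if ∀ j : Fin k, (1 : ℝ) / 4 < holeTerm k j y then φ (levelFun k y) else 0 with hχ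
  set V : EuclideanSpace ℝ (Fin 4) → EuclideanSpace ℝ (Fin 4) := fun y => (χ y / (2 * S y)) • gradG y with hV
  -- `dG(gradG) = 2 S`
  have hfd : ∀ y, (∀ j, holeTerm k j y ≠ 0) → fderiv ℝ (levelFun k) y (gradG y) = 2 * S y := by
    intro y hy
    rw [fderiv_levelFun_apply hy]
    simp only [hgradG, hS, ha, hb]
    simp
    ring
  -- `S > 0` on `{G ≥ 19/20 + 1/100}` hence on `{G ≥ 1 - 10ε}`
  have hSpos : ∀ y, (∀ j, holeTerm k j y ≠ 0) → 1 - 10 * ε < levelFun k y → 0 < S y := by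
    intro y hy hG
    by_cases hg : 19 / 20 ≤ levelFun k y - ((y 2) ^ 2 + (y 3) ^ 2)
    · have h := gradSq_pos hy hg
      simp only [hS, ha, hb]
      nlinarith [sq_nonneg (y 2), sq_nonneg (y 3)]
    · push Not at hg
      have h1 : 0 < (y 2) ^ 2 + (y 3) ^ 2 := by linarith
      simp only [hS]
      nlinarith [sq_nonneg (a y), sq_nonneg (b y)]
  have hpos4 : ∀ y, (∀ j, (1 : ℝ) / 4 < holeTerm k j y) → ∀ j, 0 < holeTerm k j y :=
    fun y h j => lt_trans (by norm_num) (h j)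
  have hχeq : ∀ y, (∀ j, (1 : ℝ) / 4 < holeTerm k j y) → χ y = φ (levelFun k y) := fun y h => by
    simp only [hχ, if_pos h]
  have hχne : ∀ y, χ y ≠ 0 → (∀ j, (1 : ℝ) / 4 < holeTerm k j y) ∧
      1 - 9 * ε < levelFun k y ∧ levelFun k y < 1 + 9 * ε := by
    intro y h
    simp only [hχ] at h
    split_ifs at h with h4
    · exact ⟨h4, hφ0 _ h⟩
    · exact absurd rfl h
  -- smoothness of the ingredients off the poles
  have hgrad : ∀ y, (∀ j, holeTerm k j y ≠ 0) → ContDiffAt ℝ ∞ gradG y := by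
    intro y hy
    rw [contDiffAt_euclidean]
    intro i
    fin_cases i
    · simpa [hgradG] using contDiffAt_gRe hy
    · simpa [hgradG] using contDiffAt_gIm hy
    · simp [hgradG]; fun_prop
    · simp [hgradG]; fun_prop
  have hSs : ∀ y, (∀ j, holeTerm k j y ≠ 0) → ContDiffAt ℝ ∞ S y := by
    intro y hy
    have h2 : ContDiffAt ℝ ∞ (fun y : EuclideanSpace ℝ (Fin 4) => y 2 ^ 2) y := by fun_prop
    have h3 : ContDiffAt ℝ ∞ (fun y : EuclideanSpace ℝ (Fin 4) => y 3 ^ 2) y := by fun_prop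
    simp only [hS]
    exact ((((contDiffAt_gRe hy).pow 2).add ((contDiffAt_gIm hy).pow 2)).add h2).add h3
  -- smoothness of the field
  have hVs : ContDiff ℝ ∞ V := by
    rw [contDiff_iff_contDiffAt]
    intro y
    by_cases hy4 : ∀ j : Fin k, (1 : ℝ) / 4 < holeTerm k j y
    · have hy0 : ∀ j, holeTerm k j y ≠ 0 := fun j => (hpos4 y hy4 j).ne'
      by_cases hG : 1 - 10 * ε < levelFun k y
      · -- the generic formula, `S > 0` nearby
        have hopen : ∀ᶠ y' in 𝓝 y, (∀ j : Fin k, (1 : ℝ) / 4 < holeTerm k j y') ∧ 1 - 10 * ε < levelFun k y' := by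
          have h1 : ∀ᶠ y' in 𝓝 y, ∀ j : Fin k, (1 : ℝ) / 4 < holeTerm k j y' :=
            (isOpen_guard (1 / 4)).mem_nhds hy4
          have h2 : ∀ᶠ y' in 𝓝 y, 1 - 10 * ε < levelFun k y' :=
            (contDiffAt_levelFun hy0).continuousAt.eventually (isOpen_Ioi.mem_nhds hG)
          exact h1.and h2
        have hev : V =ᶠ[𝓝 y] fun y' => (φ (levelFun k y') / (2 * S y')) • gradG y' := by
          filter_upwards [hopen] with y' hy'
          simp only [hV, hχeq y' hy'.1]
        refine ContDiffAt.congr_of_eventuallyEq ?_ hev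
        have hS0 : 2 * S y ≠ 0 := mul_ne_zero two_ne_zero (hSpos y hy0 hG).ne'
        exact ((hφs.contDiffAt.comp y (contDiffAt_levelFun hy0)).div
          (contDiffAt_const.mul (hSs y hy0)) hS0).smul (hgrad y hy0)
      · -- below the support of the cutoff: the field vanishes nearby
        push Not at hG
        have hopen : ∀ᶠ y' in 𝓝 y, (∀ j : Fin k, (1 : ℝ) / 4 < holeTerm k j y') ∧ levelFun k y' < 1 - 9 * ε := by
          have h1 : ∀ᶠ y' in 𝓝 y, ∀ j : Fin k, (1 : ℝ) / 4 < holeTerm k j y' :=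
            (isOpen_guard (1 / 4)).mem_nhds hy4
          have h2 : ∀ᶠ y' in 𝓝 y, levelFun k y' < 1 - 9 * ε :=
            (contDiffAt_levelFun hy0).continuousAt.eventually
              (isOpen_Iio.mem_nhds (show levelFun k y < 1 - 9 * ε by linarith))
          exact h1.and h2
        have hev : V =ᶠ[𝓝 y] fun _ => 0 := by
          filter_upwards [hopen] with y' hy'
          have hχ0 : χ y' = 0 := by
            by_contra h
            linarith [(hχne y' h).2.1, hy'.2]
          simp only [hV, hχ0, zero_div, zero_smul]
        exact (contDiffAt_const (c := (0 : EuclideanSpace ℝ (Fin 4)))).congr_of_eventuallyEq hev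
    · -- near a pole: the field vanishes nearby
      push Not at hy4
      obtain ⟨j, hj⟩ := hy4
      have hev : V =ᶠ[𝓝 y] fun _ => 0 := by
        have hopen : IsOpen {y' : EuclideanSpace ℝ (Fin 4) | holeTerm k j y' < 1 / 2} :=
          isOpen_lt (continuous_holeTerm j) continuous_const
        filter_upwards [hopen.mem_nhds (show holeTerm k j y < 1 / 2 by linarith)] with y' hy'
        have hχ0 : χ y' = 0 := by
          by_contra h
          obtain ⟨h4, -, hlt⟩ := hχne y' h
          have h2 := (FriendsH2.levelFun_bounds (hpos4 y' h4)).2.2 j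
          have h3 : 2 < 1 / holeTerm k j y' := by
            rw [lt_one_div two_pos (hpos4 y' h4 j)]; exact hy'
          linarith
        simp only [hV, hχ0, zero_div, zero_smul]
      exact (contDiffAt_const (c := (0 : EuclideanSpace ℝ (Fin 4)))).congr_of_eventuallyEq hev
  refine ⟨V, hVs, fun y hy => ?_, fun y hy hG => ?_⟩
  · -- support
    by_contra h
    have hχ0 : χ y ≠ 0 := fun h0 => h (by simp only [hV, h0, zero_div, zero_smul])
    obtain ⟨h4, -, hlt⟩ := hχne y hχ0
    have h1 := FriendsH2.norm_sq_le_levelFun (hpos4 y h4)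
    rw [← hRdef] at h1
    have hR0 : 0 < R := by linarith
    have hε9 : 9 * ε ≤ 1 := by linarith
    have h2 : levelFun k y * (R ^ 2 + 1) ≤ 2 * (R ^ 2 + 1) :=
      mul_le_mul_of_nonneg_right (by linarith) (by positivity)
    have h3 : (2 * R) ^ 2 ≤ ‖y‖ ^ 2 := pow_le_pow_left₀ (by positivity) hy 2
    nlinarith
  · -- the clock identity on the clock zone
    have h4 : ∀ j, (1 : ℝ) / 4 < holeTerm k j y := fun j => lt_trans (by norm_num) (hy j)
    have hy0 : ∀ j, holeTerm k j y ≠ 0 := fun j => (hpos4 y h4 j).ne'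
    have habs := abs_lt.1 hG
    have hχ1 : χ y = 1 := by
      rw [hχeq y h4]
      exact hφ1 _ (by linarith [habs.1]) (by linarith [habs.2])
    have hS0 : S y ≠ 0 := (hSpos y hy0 (by linarith [habs.1])).ne'
    simp only [hV, map_smul, hfd y hy0, hχ1, smul_eq_mul]
    field_simp

end FriendsCarrierVk

open FriendsCarrierVk in
/-- **Helper `helper_friendsCarrier_Vk_levelField`** (registered piece of `helper_friendsCarrier_Vk`:
Milnor's unit-clock field for the model level function).  For every `k` and `0 < ε ≤ 1/200` there is a
`C^∞` vector field `V` on `ℝ⁴`, vanishing outside the ball of radius `2 · 40(k+1)`, with `dG_k(V) = 1`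
on the clock zone `{∀ j, |z - c_j|² > 1/2} ∩ {|G_k - 1| < 3ε}` — the input of
`helper_friendsCarrier_Vk_clockFlow`. [cite: Milnor1963, Thm. 3.1] -/
theorem helper_friendsCarrier_Vk_levelField : ∀ (k : ℕ) (ε : ℝ), 0 < ε → ε ≤ 1 / 200 → ∃ V : EuclideanSpace ℝ (Fin 4) → EuclideanSpace ℝ (Fin 4), ContDiff ℝ ((⊤ : ℕ∞) : WithTop ℕ∞) V ∧ (∀ y, 2 * (40 * ((k : ℝ) + 1)) ≤ ‖y‖ → V y = 0) ∧ (∀ y, (∀ j, (1 : ℝ) / 2 < Literature.Topology.FourManifolds.MMSW.holeTerm k j y) → |Literature.Topology.FourManifolds.MMSW.levelFun k y - 1| < 3 * ε → fderiv ℝ (Literature.Topology.FourManifolds.MMSW.levelFun k) y (V y) = 1) :=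
  fun k _ hε0 hε => exists_levelField k hε0 hε

end Summit.SmoothPoincare4.SmoothPoincare4.Theorems.DcrGap.MkFriends

end
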